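import Literature.NumberTheory.ModularForms.InterpolationKernelsClassP
import Literature.NumberTheory.ModularForms.Lemma49Minus8
import HarnessLib

/-!
# The kernel numerators vanish on the diagonals `z = τ` and `z = Sτ`

Cohn–Kumar–Miller–Radchenko–Viazovska, arXiv:1902.05438, Theorem 4.1 (3) with `φ(I) = φ(S) = 0` and
§5.1 ("the imaginary axis itself … does not contribute any poles since part (3) of Theorem 4.1 shows that
`𝒦(τ,it)` is holomorphic at `τ = it` and `τ = i/t`"). In terms of the numerators
`N = Δ(τ)Δ(z)^m(j(τ)−j(z))·𝒦` of `InterpolationKernelsClassP`, the absence of these poles is the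
vanishing of `N` on the two hypersurfaces `z = τ` and `z = Sτ`, which we PROVE here as exact
identities for all four kernels (`numPlus8_self`, `numPlus8_S_smul`, …, `numMinus24_S_smul`):
for the plus kernels they are polynomial identities in `τ, E₂, E₄, E₆, Δ`
(e.g. `φ₋₂φ̃₂ − 2φ₀φ̃₀ + φ₂φ̃₋₂ = 0`, `φ₋₂E₂² − 2φ₀E₂ + φ₂ = 0`), for the minus kernels polynomial
identities in `U, V, W, 𝓛, 𝓛_S` after `E₄, E₆, Δ` are written in thetas and `U = V + W` is used.

## References

* H. Cohn, A. Kumar, S. D. Miller, D. Radchenko, M. Viazovska, Ann. of Math. 196 (2022),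
  arXiv:1902.05438, Theorem 4.1 (3), §5.1. [CohnEtAl2019]
-/

noncomputable section

open Complex hiding I
open Filter Topology Asymptotics ModularForm SlashInvariantForm EisensteinSeries
open UpperHalfPlane hiding I
open Complex (I)
open scoped Real MatrixGroups ModularForm Manifold

namespace Literature.NumberTheory.ModularForms

open Literature.NumberTheory.EllipticCurves.ModularForms (kleinJ kleinJ_smul)

/-- `R(τ,τ) = 0`. [folklore] -/
theorem jResultant_self (τ : ℍ) : jResultant τ τ = 0 := by simp [jResultant]

/-- `R(τ,Sτ) = 0` (as `E₄(Sτ) = τ⁴E₄(τ)`, `Δ(Sτ) = τ¹²Δ(τ)`). [folklore] -/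
theorem jResultant_S_smul (τ : ℍ) : jResultant τ (ModularGroup.S • τ) = 0 := by
  simp only [jResultant, E₄_S_smul, discriminant_S_smul']; ring

/-! ## The plus kernels -/

/-- **`N₊^{(8)}(τ,τ) = 0`** (`φ₋₂φ̃₂ − 2φ₀φ̃₀ + φ₂φ̃₋₂ = 0`). [cite: CohnEtAl2019, Theorem 4.1 (3)] -/
theorem numPlus8_self (τ : ℍ) : numPlus8 τ τ = 0 := by
  simp only [numPlus8, jResultant_self, phiNeg2, phi0, phi2, phiTildeNeg2, phiTilde0, phiTilde2, E8fun, E10fun, E14fun,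
    Pi.mul_apply]
  ring

/-- **`N₊^{(8)}(τ,Sτ) = 0`** (`φ₋₂E₂² − 2φ₀E₂ + φ₂ = 0`). [cite: CohnEtAl2019, Theorem 4.1 (3)] -/
theorem numPlus8_S_smul (τ : ℍ) : numPlus8 τ (ModularGroup.S • τ) = 0 := by
  have hτ : (τ : ℂ) ≠ 0 := τ.ne_zero
  simp only [numPlus8, jResultant_S_smul, phiNeg2, phi0, phi2, phiTildeNeg2_S_smul, phiTilde0_S_smul, phiTilde2_S_smul,
    E8fun, E10fun, E14fun, Pi.mul_apply, E₄_S_smul, E₆_S_smul, discriminant_S_smul']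
  field_simp
  ring

/-- **`N₊^{(24)}(τ,τ) = 0`**. [cite: CohnEtAl2019, Theorem 4.1 (3)] -/
theorem numPlus24_self (τ : ℍ) : numPlus24 τ τ = 0 := by
  simp only [numPlus24, jResultant_self, phiNeg2, phi0, phi2, phiTildeNeg2, phiTilde0, phiTilde2, E10fun, E14fun,
    Pi.mul_apply]
  ring

/-- **`N₊^{(24)}(τ,Sτ) = 0`**. [cite: CohnEtAl2019, Theorem 4.1 (3)] -/
theorem numPlus24_S_smul (τ : ℍ) : numPlus24 τ (ModularGroup.S • τ) = 0 := by
  have hτ : (τ : ℂ) ≠ 0 := τ.ne_zero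
  simp only [numPlus24, jResultant_S_smul, phiNeg2, phi0, phi2, phiTildeNeg2_S_smul, phiTilde0_S_smul, phiTilde2_S_smul,
    E10fun, E14fun, Pi.mul_apply, E₄_S_smul, E₆_S_smul, discriminant_S_smul']
  field_simp
  ring

/-! ## The minus kernels (via the theta expressions of `E₄, E₆, Δ` and `U = V + W`) -/

/-- **`N₋^{(8)}(τ,τ) = 0`**. [cite: CohnEtAl2019, Theorem 4.1 (3)] -/
theorem numMinus8_self (τ : ℍ) : numMinus8 τ τ = 0 := by
  simp only [numMinus8, psi2, psi4, xi2, xi4, xi2S, xi4S, psiTilde0, psiTilde2, psiTilde4, E8fun, E10fun, E14fun,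
    Pi.add_apply, Pi.sub_apply, Pi.mul_apply, Pi.neg_apply, Pi.smul_apply, smul_eq_mul,
    E₄_eq_theta τ, E₆_eq_theta τ, discriminant_eq_theta τ, thetaU_apply_eq τ]
  ring

/-- **`N₋^{(8)}(τ,Sτ) = 0`** (using `𝓛(Sτ) = 𝓛_S(τ)`, `W(Sτ) = −τ²V`, `U(Sτ) = −τ²U`, `V(Sτ) = −τ²W`).
[cite: CohnEtAl2019, Theorem 4.1 (3)] -/
theorem numMinus8_S_smul (τ : ℍ) : numMinus8 τ (ModularGroup.S • τ) = 0 := by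
  obtain ⟨hU, hV, hW⟩ := thetaUVW_S_smul τ
  simp only [numMinus8, psi2, psi4, xi2, xi4, xi2S, xi4S, psiTilde0, psiTilde2, psiTilde4, E8fun, E10fun, E14fun,
    Pi.add_apply, Pi.sub_apply, Pi.mul_apply, Pi.neg_apply, Pi.smul_apply, smul_eq_mul, logLambda_S_smul,
    E₄_S_smul, E₆_S_smul, hU, hV, hW,
    E₄_eq_theta τ, E₆_eq_theta τ, discriminant_eq_theta τ, thetaU_apply_eq τ]
  ring

/-- **`N₋^{(24)}(τ,τ) = 0`**. [cite: CohnEtAl2019, Theorem 4.1 (3)] -/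
theorem numMinus24_self (τ : ℍ) : numMinus24 τ τ = 0 := by
  simp only [numMinus24, jResultant_self, psi2, psi4, xi2, xi4, xi2S, xi4S, psiTilde0, psiTilde2, psiTilde4, E8fun, E10fun, E14fun,
    Pi.add_apply, Pi.sub_apply, Pi.mul_apply, Pi.neg_apply, Pi.smul_apply, smul_eq_mul,
    E₄_eq_theta τ, E₆_eq_theta τ, discriminant_eq_theta τ, thetaU_apply_eq τ]
  ring

/-- **`N₋^{(24)}(τ,Sτ) = 0`**. [cite: CohnEtAl2019, Theorem 4.1 (3)] -/
theorem numMinus24_S_smul (τ : ℍ) : numMinus24 τ (ModularGroup.S • τ) = 0 := by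
  obtain ⟨hU, hV, hW⟩ := thetaUVW_S_smul τ
  simp only [numMinus24, jResultant_S_smul, psi2, psi4, xi2, xi4, xi2S, xi4S, psiTilde0, psiTilde2, psiTilde4, E8fun, E10fun, E14fun,
    Pi.add_apply, Pi.sub_apply, Pi.mul_apply, Pi.neg_apply, Pi.smul_apply, smul_eq_mul, logLambda_S_smul,
    E₄_S_smul, E₆_S_smul, discriminant_S_smul', hU, hV, hW,
    E₄_eq_theta τ, E₆_eq_theta τ, discriminant_eq_theta τ, thetaU_apply_eq τ]
  ring

/-! ## Consequence: no contribution from the axis (`𝒦(τ,τ) = 𝒦(τ,Sτ) = 0` as defined) -/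

/-- The Lean values on the diagonals are the junk value `0` and the numerators vanish there, so in the
representation `𝒦 = N/(ΔΔ^m(j−j))` both sides are `0` on `z = τ`, `z = Sτ`. [cite: CohnEtAl2019, §5.1] -/
theorem kernels_self_and_S (τ : ℍ) :
    kernelPlus8 τ τ = 0 ∧ kernelMinus8 τ τ = 0 ∧ kernelPlus24 τ τ = 0 ∧ kernelMinus24 τ τ = 0 ∧
    kernelPlus8 τ (ModularGroup.S • τ) = 0 ∧ kernelMinus8 τ (ModularGroup.S • τ) = 0 ∧
    kernelPlus24 τ (ModularGroup.S • τ) = 0 ∧ kernelMinus24 τ (ModularGroup.S • τ) = 0 := by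
  refine ⟨?_, ?_, ?_, ?_, ?_, ?_, ?_, ?_⟩
  · rw [kernelPlus8_eq_div, numPlus8_self, zero_div]
  · rw [kernelMinus8_eq_div, numMinus8_self, zero_div]
  · rw [kernelPlus24_eq_div, numPlus24_self, zero_div]
  · rw [kernelMinus24_eq_div, numMinus24_self, zero_div]
  · rw [kernelPlus8_eq_div, numPlus8_S_smul, zero_div]
  · rw [kernelMinus8_eq_div, numMinus8_S_smul, zero_div]
  · rw [kernelPlus24_eq_div, numPlus24_S_smul, zero_div]
  · rw [kernelMinus24_eq_div, numMinus24_S_smul, zero_div]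

end Literature.NumberTheory.ModularForms
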